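import Literature.NumberTheory.Automorphic.ResGLnTraceFormEmbeddings
import Literature.NumberTheory.Automorphic.GLnCasimirHCPolynomial
import Literature.NumberTheory.Automorphic.ArchParameterSplitCentre
import HarnessLib

/-!
# The trace-form Casimir operator of `𝔤𝔩ₙ(K_∞)` on a module with an archimedean parameter:
# `C = ∑_σ (∑_{s ∈ χ(σ)} s² - |ρ|²)`, and its value on the forms of an automorphic representation

Topic `NumberTheory/Automorphic`; namespaces `Literature.NumberTheory.Automorphic.ResGLnCartan` (the
Lie algebra `𝔤 = 𝔤𝔩ₙ(K_∞)`, its real trace form `B(X, Y) = Tr_{K_∞/ℝ} tr(XY)`, the adapted basis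
`adaptedBasis` and its `B`-dual `dualB` of `ResGLnCartanData`, the matrix basis `matBasis` of
`ResGLnTraceFormEmbeddings`) and `…ConeDictionary` (the same over the automorphy datum: `𝔤D`, `bD`,
`dD`, and the forms `W` of an automorphic representation `π` of `GL_n(𝔸_K)`).  Theorems only; no
definition, no named fact, no `sorry`.

The VALUE of the Casimir operator `C = ∑_t ρ(b_t) ρ(b^t)` of the trace form (the operator of Kuga's
lemma, `ResGLnKugaHarmonic.d_eq_zero_and_coclosed_of_casimir_scalar`, hypothesis `hc`) on a
`𝔤𝔩ₙ(K_∞)`-module with archimedean (Harish-Chandra) parameter `χ = (χ(σ))_{σ : K → ℂ}`: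

* `single_realPlace`, `single_complexPlace` — the matrix units `E_{ab} e_s` of the standard basis of
  `K_∞` are the place embeddings `realPlaceLie w (E_{ab})`, `complexPlaceLie w (E_{ab})`, `complexPlaceLie w (iE_{ab})`;
* **`sum_bilin_adaptedBasis_dualB_places`** — THE PLACE DECOMPOSITION OF THE CANONICAL TENSOR: for every
  real-bilinear `Φ` on `𝔤`, `∑_t Φ(b_t, b^t) = ∑_{w real} ∑_{a,b} Φ(E_{ab}^w, E_{ba}^w)
  + ∑_{w complex} ∑_{a,b} (Φ(E_{ab}^w, ½E_{ba}^w) + Φ(iE_{ab}^w, -(i/2)E_{ba}^w))` (basis independence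
  `Literature.Algebra.Lie.sum_basis_dualBasis_eq`, then the matrix basis and its trace-dual
  `e^s = 1_w; ½_w, (-i/2)_w` of `MixedSpaceTraceDual`) [cite: BorelWallach2000, I §2.3];
* `op_adaptedBasis_apply_eq_places` — hence `C = ∑_{w real} C_w + ∑_{w complex} ½ C₊,w` for a Lie
  action `ρ`, with `C_w = ∑ ρ_w(E_{ab}) ρ_w(E_{ba})` the Casimir operator of `𝔤𝔩ₙ(ℝ) = 𝔤𝔩ₙ(K_w)` and
  `C₊,w` the real Casimir operator of `Re tr` on `𝔤𝔩ₙ(ℂ) = 𝔤𝔩ₙ(K_w)` (`GLnComplexCasimir.casPlus`);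
* **`op_adaptedBasis_apply_of_hasArchParameter`** — on a module of archimedean parameter `χ`,
  `C v = (∑_{σ : K → ℂ} (∑_{s ∈ χ(σ)} s² - ∑_a ρ_a²)) v`: place by place by the Harish-Chandra
  polynomials `γ(C_w)(x) = ∑ x_a² - |ρ|²`, `γ(C₊,w)(x) = 2 ∑_τ (∑ x_{τ,a}² - |ρ|²)` of
  `GLnCasimirHCPolynomial` [cite: Knapp2002, Thm. 5.44], and `∑_σ = ∑_{w real} + ∑_{w complex} (σ_w + σ̄_w)`;
* `op_bD_dD_apply_of_hasArchParameter` — the same over the datum; **`op_lieRepW_apply_of_hasArchParameter`**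
  — for an automorphic representation `π = W / ⊥` of `GL_n(𝔸_K)` with `π.HasArchParameter χ`, the
  trace-form Casimir operator acts on `W` by `∑_σ (∑_{s ∈ χ(σ)} s² - |ρ|²)` (through the Lie action on
  `W / W'`, `HasLieAction`) [cite: BorelJacquet1979, 4.6];
* **`op_lieRepW_apply_of_cohomological`** — for `π` with the cohomological infinity type of `λ^∨`
  (the hypothesis of Clozel's apex fact), `C = ∑_σ (∑_i (λ_{σ,i} + ρ_i)² - ∑_i ρ_i²)` on `W` — the
  Casimir scalar `|λ + ρ|² - |ρ|²` of `E_λ^*`, input (i) of the Kuga reduction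
  `ResGLnCuspidalCohomologyApexKuga` [cite: BorelWallach2000, II §3.1] [cite: Clozel1990, Lemme 3.14 (p. 114)].

## References

* A. Borel, N. Wallach, *Continuous cohomology, discrete subgroups, and representations of reductive
  groups*, 2nd ed. (2000), I §2.3, II §3.1 (held). [BorelWallach2000]
* A. W. Knapp, *Lie Groups Beyond an Introduction*, 2nd ed. (2002), §V.4–V.5, Thm. 5.44. [Knapp2002]
* A. Borel, H. Jacquet, *Automorphic forms and automorphic representations*, Corvallis (1979), 4.6.
  [BorelJacquet1979]
* L. Clozel, *Motifs et formes automorphes* (1990), §3.3, Lemme 3.14 (p. 114). [Clozel1990]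
-/

noncomputable section

namespace Literature.NumberTheory.Automorphic

-- Mathlib idiom (as in `GKModules`): commutator bracket on matrix algebras and `Module.End`
attribute [local instance 100] LieRing.ofAssociativeRing

-- `Classical`: the place subtypes indexing `mixedSpace K` are `Fintype` classically (as in `AdelicGLnGlue`).
open scoped TensorProduct Classical _root_.Matrix ComplexConjugate
open _root_.NumberField _root_.NumberField.InfinitePlace _root_.NumberField.mixedEmbedding Finset
  _root_.UniversalEnvelopingAlgebra Complex

namespace ResGLnCartan

variable {n : ℕ} {K : Type} [Field K] [NumberField K]

/-! ### The matrix units of the standard basis are the place embeddings -/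

omit [NumberField K] in
/-- `E_{ab} (x)_w = realPlaceLie w (x E_{ab})` for a real place `w`. [folklore] -/
theorem single_realPlace (a b : Fin n) (w : {w : InfinitePlace K // IsReal w}) (x : ℝ) :
    Matrix.single a b ((Pi.single w x, 0) : mixedSpace K) = realPlaceLie n w (Matrix.single a b x) := by
  ext i j : 1
  rw [realPlaceLie_apply, Matrix.single_apply, Matrix.single_apply]
  split_ifs with h
  · rfl
  · rw [Pi.single_zero]; rfl

omit [NumberField K] in
/-- `E_{ab} (z)_w = complexPlaceLie w (z E_{ab})` for a complex place `w`. [folklore] -/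
theorem single_complexPlace (a b : Fin n) (w : {w : InfinitePlace K // IsComplex w}) (z : ℂ) :
    Matrix.single a b ((0, Pi.single w z) : mixedSpace K) = complexPlaceLie n w (Matrix.single a b z) := by
  ext i j : 1
  rw [complexPlaceLie_apply, Matrix.single_apply, Matrix.single_apply]
  split_ifs with h
  · rfl
  · rw [Pi.single_zero]; rfl

/-- The matrix basis vector at a real place. [folklore] -/
theorem matBasis_inl (a b : Fin n) (w : {w : InfinitePlace K // IsReal w}) :
    matBasis n K (a, b, Sum.inl w) = ofMatrix (realPlaceLie n w (Matrix.single a b 1)) := by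
  rw [matBasis_apply, ← single_realPlace]
  rfl

/-- The dual vector at a real place. [folklore] -/
theorem matDual_inl (a b : Fin n) (w : {w : InfinitePlace K // IsReal w}) :
    matDual n K (a, b, Sum.inl w) = ofMatrix (realPlaceLie n w (Matrix.single b a 1)) := by
  rw [matDual_apply, MixedTraceDual.eDual_inl, ← single_realPlace]
  rfl

/-- The matrix basis vectors at a complex place: `E_{ab} 1_w`, `E_{ab} i_w`. [folklore] -/
theorem matBasis_inr (a b : Fin n) (w : {w : InfinitePlace K // IsComplex w}) (j : Fin 2) :
    matBasis n K (a, b, Sum.inr ⟨w, j⟩) =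
      ofMatrix (complexPlaceLie n w (Matrix.single a b (if j = 0 then 1 else I))) := by
  rw [matBasis_apply, MixedTraceDual.e_inr, ← single_complexPlace]

/-- The dual vectors at a complex place: `E_{ba} ½_w`, `E_{ba} (-i/2)_w`. [folklore] -/
theorem matDual_inr (a b : Fin n) (w : {w : InfinitePlace K // IsComplex w}) (j : Fin 2) :
    matDual n K (a, b, Sum.inr ⟨w, j⟩) =
      ofMatrix (complexPlaceLie n w (Matrix.single b a (if j = 0 then 2⁻¹ else -(I / 2)))) := by
  rw [matDual_apply, MixedTraceDual.eDual_inr, ← single_complexPlace]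

/-! ### The place decomposition of the canonical tensor of the trace form -/

/-- **The canonical tensor of the trace form, place by place**: for every real-bilinear `Φ` on `𝔤`,
`∑_t Φ(b_t, b^t) = ∑_{w real} ∑_{a,b} Φ(E_{ab}^w, E_{ba}^w) + ∑_{w complex} ∑_{a,b} (Φ(E_{ab}^w, ½ E_{ba}^w)
+ Φ(i E_{ab}^w, -(i/2) E_{ba}^w))` — over the adapted basis `b` and its `B`-dual (by basis independence
over ANY basis; evaluated on the matrix basis `E_{ab} e_s` and its trace-dual `E_{ba} e^s`).
[cite: BorelWallach2000, I §2.3] -/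
theorem sum_bilin_adaptedBasis_dualB_places {P : Type*} [AddCommGroup P] [Module ℝ P]
    (Φ : 𝔤 n K →ₗ[ℝ] 𝔤 n K →ₗ[ℝ] P) :
    ∑ t, Φ (adaptedBasis n K t) (dualB n K t) =
      (∑ w : {w : InfinitePlace K // IsReal w}, ∑ a : Fin n, ∑ b : Fin n,
          Φ (ofMatrix (realPlaceLie n w (Matrix.single a b 1))) (ofMatrix (realPlaceLie n w (Matrix.single b a 1)))) +
        ∑ w : {w : InfinitePlace K // IsComplex w}, ∑ a : Fin n, ∑ b : Fin n,
          (Φ (ofMatrix (complexPlaceLie n w (Matrix.single a b 1)))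
              (ofMatrix (complexPlaceLie n w (Matrix.single b a 2⁻¹))) +
            Φ (ofMatrix (complexPlaceLie n w (Matrix.single a b I)))
              (ofMatrix (complexPlaceLie n w (Matrix.single b a (-(I / 2)))))) := by
  have key := Literature.Algebra.Lie.sum_basis_dualBasis_eq trForm_nondegenerate trForm_isSymm Φ (adaptedBasis n K)
    (matBasis n K)
  rw [show (fun t => Φ (adaptedBasis n K t) (dualB n K t)) =
      fun t => Φ (adaptedBasis n K t) ((trForm n K).dualBasis trForm_nondegenerate (adaptedBasis n K) t) from rfl, key]
  simp only [dualBasis_matBasis]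
  rw [Fintype.sum_prod_type]
  simp only [Fintype.sum_prod_type (f := fun x : Fin n × index K => Φ (matBasis n K (_, x)) (matDual n K (_, x)))]
  simp only [Fintype.sum_sum_type, matBasis_inl, matDual_inl]
  have h2 : ∀ (a b : Fin n) (w : {w : InfinitePlace K // IsComplex w}),
      (∑ j : Fin 2, Φ (matBasis n K (a, b, Sum.inr ⟨w, j⟩)) (matDual n K (a, b, Sum.inr ⟨w, j⟩))) =
        Φ (ofMatrix (complexPlaceLie n w (Matrix.single a b 1))) (ofMatrix (complexPlaceLie n w (Matrix.single b a 2⁻¹))) +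
          Φ (ofMatrix (complexPlaceLie n w (Matrix.single a b I)))
            (ofMatrix (complexPlaceLie n w (Matrix.single b a (-(I / 2))))) := fun a b w => by
    rw [Fin.sum_univ_two, matBasis_inr, matDual_inr, matBasis_inr, matDual_inr]
    simp only [Fin.isValue, if_true, one_ne_zero, if_false]
  simp only [Fintype.sum_prod_type (f := fun x : {w : InfinitePlace K // IsComplex w} × Fin 2 =>
    Φ (matBasis n K (_, _, Sum.inr x)) (matDual n K (_, _, Sum.inr x))), h2]
  -- reorder `∑_a ∑_b ∑_w` to `∑_w ∑_a ∑_b`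
  have hcomm : ∀ (J : Type) [Fintype J] (f : Fin n → Fin n → J → P),
      (∑ a : Fin n, ∑ b : Fin n, ∑ w : J, f a b w) = ∑ w : J, ∑ a : Fin n, ∑ b : Fin n, f a b w := fun J _ f =>
    calc (∑ a : Fin n, ∑ b : Fin n, ∑ w : J, f a b w)
        = ∑ a : Fin n, ∑ w : J, ∑ b : Fin n, f a b w := Finset.sum_congr rfl fun a _ => Finset.sum_comm
      _ = ∑ w : J, ∑ a : Fin n, ∑ b : Fin n, f a b w := Finset.sum_comm
  simp only [Finset.sum_add_distrib]
  rw [hcomm {w : InfinitePlace K // IsReal w}, hcomm {w : InfinitePlace K // IsComplex w},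
    hcomm {w : InfinitePlace K // IsComplex w}]

/-! ### The Casimir operator of a Lie action: `C = ∑_{w real} C_w + ∑_{w complex} ½ C₊,w` -/

section Operator

variable {V : Type*} [AddCommGroup V] [Module ℂ V] (ρ : 𝔤 n K →ₗ⁅ℝ⁆ Module.End ℂ V)

/-- **The trace-form Casimir operator of a Lie action `ρ` of `𝔤`, place by place**, applied to a vector.
[cite: BorelWallach2000, I §2.3] -/
theorem op_adaptedBasis_apply_eq_places (v : V) :
    GKCasimir.op (archGroupGL n K) ρ (adaptedBasis n K) (dualB n K) v =
      (∑ w : {w : InfinitePlace K // IsReal w}, ∑ a : Fin n, ∑ b : Fin n,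
          ρ (ofMatrix (realPlaceLie n w (Matrix.single a b 1))) (ρ (ofMatrix (realPlaceLie n w (Matrix.single b a 1))) v)) +
        ∑ w : {w : InfinitePlace K // IsComplex w}, ∑ a : Fin n, ∑ b : Fin n,
          (ρ (ofMatrix (complexPlaceLie n w (Matrix.single a b 1)))
              (ρ (ofMatrix (complexPlaceLie n w (Matrix.single b a 2⁻¹))) v) +
            ρ (ofMatrix (complexPlaceLie n w (Matrix.single a b I)))
              (ρ (ofMatrix (complexPlaceLie n w (Matrix.single b a (-(I / 2))))) v)) := by
  have h := sum_bilin_adaptedBasis_dualB_places (GKCasimir.mulBilin (W := V) (archGroupGL n K) ρ ρ)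
  simp only [GKCasimir.mulBilin_apply] at h
  have hv := congrArg (fun T : Module.End ℂ V => T v) h
  simp only [LinearMap.add_apply, LinearMap.sum_apply, Module.End.mul_apply] at hv
  rw [GKCasimir.op_apply]
  exact hv

/-- The restriction of `ρ` to the factor `𝔤𝔩ₙ(ℝ) = 𝔤𝔩ₙ(K_w)` at a real place, through the
identification `𝔤 = ⊤ ≅ 𝔤𝔩ₙ(K_∞)` entering `HasArchParameter`. [folklore] -/
theorem comp_topEquiv_realPlaceLie_apply (w : {w : InfinitePlace K // IsReal w}) (X : Matrix (Fin n) (Fin n) ℝ) :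
    ((ρ.comp (LieSubalgebra.topEquiv : (⊤ : LieSubalgebra ℝ (Matrix (Fin n) (Fin n) (mixedSpace K))) ≃ₗ⁅ℝ⁆
        Matrix (Fin n) (Fin n) (mixedSpace K)).symm.toLieHom).comp (realPlaceLie n w)) X =
      ρ (ofMatrix (realPlaceLie n w X)) :=
  rfl

/-- The same at a complex place. [folklore] -/
theorem comp_topEquiv_complexPlaceLie_apply (w : {w : InfinitePlace K // IsComplex w}) (X : Matrix (Fin n) (Fin n) ℂ) :
    ((ρ.comp (LieSubalgebra.topEquiv : (⊤ : LieSubalgebra ℝ (Matrix (Fin n) (Fin n) (mixedSpace K))) ≃ₗ⁅ℝ⁆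
        Matrix (Fin n) (Fin n) (mixedSpace K)).symm.toLieHom).comp (complexPlaceLie n w)) X =
      ρ (ofMatrix (complexPlaceLie n w X)) :=
  rfl

/-- **The real Casimir operator `C₊` of `𝔤𝔩ₙ(ℂ)` through a real Lie action `ρ'`, applied**:
`C₊ v = ∑_{a,b} (ρ'(E_{ab}) ρ'(E_{ba}) v - ρ'(iE_{ab}) ρ'(iE_{ba}) v)`. [cite: Knapp2002, §V.4 (5.24)] -/
theorem lift_casPlus_apply {W : Type*} [AddCommGroup W] [Module ℂ W]
    (ρ' : Matrix (Fin n) (Fin n) ℂ →ₗ⁅ℝ⁆ Module.End ℂ W) (v : W) :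
    lift ℝ ρ' (GLnComplexCasimir.casPlus n) v =
      ∑ a : Fin n, ∑ b : Fin n,
        (ρ' (Matrix.single a b 1) (ρ' (Matrix.single b a 1) v) - ρ' (Matrix.single a b I) (ρ' (Matrix.single b a I) v)) := by
  simp only [GLnComplexCasimir.casPlus, GLnComplexCasimir.casU, GLnComplexCasimir.gen_apply, map_sub, map_sum,
    LinearMap.sub_apply, LinearMap.sum_apply, HCProj.lift_mul_apply, HCProj.lift_ιU_apply, Finset.sum_sub_distrib]

/-- `½ E_{ba} = (½ : ℝ) • E_{ba}` and `-(i/2) E_{ba} = (-½ : ℝ) • (i E_{ba})` in `𝔤𝔩ₙ(ℂ)`. [folklore] -/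
theorem single_half_eq (a b : Fin n) :
    (Matrix.single b a (2⁻¹ : ℂ) = (2⁻¹ : ℝ) • Matrix.single b a (1 : ℂ)) ∧
      (Matrix.single b a (-(I / 2)) = (-2⁻¹ : ℝ) • Matrix.single b a I) := by
  constructor
  · rw [Matrix.smul_single]
    congr 1
    rw [Complex.real_smul]
    push_cast
    ring
  · rw [Matrix.smul_single]
    congr 1
    rw [Complex.real_smul]
    push_cast
    ring

/-- **The trace-form Casimir operator on a module with an archimedean parameter**: if the Lie action `ρ`
of `𝔤 = 𝔤𝔩ₙ(K_∞)` has archimedean parameter `χ` (`HasArchParameter`, through `𝔤 = ⊤ ≅ 𝔤𝔩ₙ(K_∞)`), then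
`C v = (∑_{σ : K → ℂ} (∑_{s ∈ χ(σ)} s² - ∑_a ρ_a²)) v` — at a real place `C_w` acts by `∑_{s ∈ χ(σ_w)} s² - |ρ|²`
(`GLnCasimir.sum_rho_single_apply_of_hasHCParameter`), at a complex place `½ C₊,w` by the sum of the
same expression over `σ_w`, `σ̄_w` (`GLnComplexCasimir.lift_casPlus_eq_of_hasHCParameter`), and
`∑_σ = ∑_{w real} + ∑_{w complex} (σ_w + σ̄_w)` (`sum_embeddings_eq_sum_places`).
[cite: Knapp2002, Thm. 5.44] [cite: BorelWallach2000, I §2.3, II §3.1] -/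
theorem op_adaptedBasis_apply_of_hasArchParameter {χ : (K →+* ℂ) → Multiset ℂ}
    (h : HasArchParameter
      (ρ.comp (LieSubalgebra.topEquiv : (⊤ : LieSubalgebra ℝ (Matrix (Fin n) (Fin n) (mixedSpace K))) ≃ₗ⁅ℝ⁆
        Matrix (Fin n) (Fin n) (mixedSpace K)).symm.toLieHom) χ) (v : V) :
    GKCasimir.op (archGroupGL n K) ρ (adaptedBasis n K) (dualB n K) v =
      (∑ σ : K →+* ℂ, (((χ σ).map fun s : ℂ => s ^ 2).sum - ∑ a : Fin n, rhoGL n a ^ 2)) • v := by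
  obtain ⟨hre, hco⟩ := h
  set F : Multiset ℂ → ℂ := fun m => (m.map fun s : ℂ => s ^ 2).sum - ∑ a : Fin n, rhoGL n a ^ 2 with hF
  -- real places: `C_w v = F(χ σ_w) v`
  have hr : ∀ w : {w : InfinitePlace K // IsReal w},
      (∑ a : Fin n, ∑ b : Fin n,
        ρ (ofMatrix (realPlaceLie n w (Matrix.single a b 1))) (ρ (ofMatrix (realPlaceLie n w (Matrix.single b a 1))) v)) =
        F (χ w.1.embedding) • v := fun w => by
    have h1 := GLnCasimir.sum_rho_single_apply_of_hasHCParameter (hre w) (Algebra.ofId ℝ ℂ) v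
    simp only [comp_topEquiv_realPlaceLie_apply] at h1
    exact h1
  -- complex places: `½ C₊,w v = (F(χ σ_w) + F(χ σ̄_w)) v`
  have hc : ∀ w : {w : InfinitePlace K // IsComplex w},
      (∑ a : Fin n, ∑ b : Fin n,
        (ρ (ofMatrix (complexPlaceLie n w (Matrix.single a b 1)))
            (ρ (ofMatrix (complexPlaceLie n w (Matrix.single b a 2⁻¹))) v) +
          ρ (ofMatrix (complexPlaceLie n w (Matrix.single a b I)))
            (ρ (ofMatrix (complexPlaceLie n w (Matrix.single b a (-(I / 2))))) v))) =
        (F (χ w.1.embedding) + F (χ (ComplexEmbedding.conjugate w.1.embedding))) • v := fun w => by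
    set ρ' := (ρ.comp (LieSubalgebra.topEquiv : (⊤ : LieSubalgebra ℝ (Matrix (Fin n) (Fin n) (mixedSpace K))) ≃ₗ⁅ℝ⁆
        Matrix (Fin n) (Fin n) (mixedSpace K)).symm.toLieHom).comp (complexPlaceLie n w) with hρ'
    have h1 := congrArg (fun T : Module.End ℂ V => T v) (GLnComplexCasimir.lift_casPlus_eq_of_hasHCParameter (hco w))
    simp only [Module.algebraMap_end_apply] at h1
    rw [lift_casPlus_apply, sum_algHom_complex, algHomId_toRingHom_comp, conjAe_toRingHom_comp] at h1
    -- the summands: `ρ'(E_{ab}) ρ'(½E_{ba}) + ρ'(iE_{ab}) ρ'(-(i/2)E_{ba}) = ½ (ρ'(E_{ab})ρ'(E_{ba}) - ρ'(iE_{ab})ρ'(iE_{ba}))`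
    have hterm : ∀ a b : Fin n,
        ρ (ofMatrix (complexPlaceLie n w (Matrix.single a b 1)))
            (ρ (ofMatrix (complexPlaceLie n w (Matrix.single b a 2⁻¹))) v) +
          ρ (ofMatrix (complexPlaceLie n w (Matrix.single a b I)))
            (ρ (ofMatrix (complexPlaceLie n w (Matrix.single b a (-(I / 2))))) v) =
        ((2⁻¹ : ℝ) : ℂ) • (ρ' (Matrix.single a b 1) (ρ' (Matrix.single b a 1) v) -
          ρ' (Matrix.single a b I) (ρ' (Matrix.single b a I) v)) := fun a b => by
      simp only [← comp_topEquiv_complexPlaceLie_apply, ← hρ']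
      rw [(single_half_eq a b).1, (single_half_eq a b).2, map_smul, map_smul, LinearMap.smul_apply,
        LinearMap.smul_apply, LinearMap.map_smul_of_tower, LinearMap.map_smul_of_tower, ← Complex.coe_smul,
        ← Complex.coe_smul]
      push_cast
      module
    simp only [hterm, ← Finset.smul_sum]
    rw [h1, smul_smul]
    congr 1
    push_cast
    ring
  rw [op_adaptedBasis_apply_eq_places]
  simp only [hr, hc, ← Finset.sum_smul, ← add_smul]
  congr 1
  rw [sum_embeddings_eq_sum_places]

end Operator

end ResGLnCartan

/-! ### Over the automorphy datum, and on the forms of an automorphic representation -/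

namespace ConeDictionary

variable {n : ℕ} {K : Type} [Field K] [NumberField K] {hcpt : isCompact_glFiniteIntegralLevel n K}

set_option maxHeartbeats 800000 in
-- one-time re-typing over the datum (definitional, as in `ResGLnKugaHarmonic`)
/-- **The trace-form Casimir operator over the datum on a module with an archimedean parameter**
(`bD`, `dD`). [cite: Knapp2002, Thm. 5.44] [cite: BorelWallach2000, I §2.3] -/
theorem op_bD_dD_apply_of_hasArchParameter {V : Type*} [AddCommGroup V] [Module ℂ V]
    (ρ : 𝔤D n K hcpt →ₗ⁅ℝ⁆ Module.End ℂ V) {χ : (K →+* ℂ) → Multiset ℂ}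
    (h : HasArchParameter
      (ρ.comp (LieSubalgebra.topEquiv : (⊤ : LieSubalgebra ℝ (Matrix (Fin n) (Fin n) (mixedSpace K))) ≃ₗ⁅ℝ⁆
        Matrix (Fin n) (Fin n) (mixedSpace K)).symm.toLieHom) χ) (v : V) :
    GKCasimir.op (AutomorphyDatum.gl n K hcpt).arch ρ (bD n K hcpt) (dD n K hcpt) v =
      (∑ σ : K →+* ℂ, (((χ σ).map fun s : ℂ => s ^ 2).sum - ∑ a : Fin n, rhoGL n a ^ 2)) • v :=
  ResGLnCartan.op_adaptedBasis_apply_of_hasArchParameter (n := n) (K := K) ρ h v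

/-- **The trace-form Casimir operator on the forms of an automorphic representation with an
archimedean parameter**: for `π = W / ⊥` with `π.HasArchParameter χ`, `C v = (∑_σ (∑_{s ∈ χ(σ)} s² - |ρ|²)) v`
for every `v ∈ W` (the Lie action on `W / W'` of `HasArchParameter` is `[v] ↦ [X v]`, `HasLieAction`).
This is the VALUE of the scalar of `ResGLnKugaCasimirScalarW.exists_op_lieRepW_eq_smul`.
[cite: BorelJacquet1979, 4.6] [cite: Knapp2002, Thm. 5.44] -/
theorem op_lieRepW_apply_of_hasArchParameter (π : AutomorphicRepData (AutomorphyDatum.gl n K hcpt))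
    (hW' : π.W' = ⊥) {χ : (K →+* ℂ) → Multiset ℂ} (hχ : π.HasArchParameter χ) (v : π.W) :
    GKCasimir.op (AutomorphyDatum.gl n K hcpt).arch π.lieRepW (bD n K hcpt) (dD n K hcpt) v =
      (∑ σ : K →+* ℂ, (((χ σ).map fun s : ℂ => s ^ 2).sum - ∑ a : Fin n, rhoGL n a ^ 2)) • v := by
  obtain ⟨ρ𝔤, hρ, hpar⟩ := hχ
  have h1 := op_bD_dD_apply_of_hasArchParameter ρ𝔤 hpar (π.mkQ v)
  -- `[C v] = C [v]` through the Lie action on `W / W'`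
  have h2 : π.mkQ (GKCasimir.op (AutomorphyDatum.gl n K hcpt).arch π.lieRepW (bD n K hcpt) (dD n K hcpt) v) =
      GKCasimir.op (AutomorphyDatum.gl n K hcpt).arch ρ𝔤 (bD n K hcpt) (dD n K hcpt) (π.mkQ v) := by
    rw [GKCasimir.op_apply, GKCasimir.op_apply, map_sum]
    refine Finset.sum_congr rfl fun t _ => ?_
    rw [π.lieRepW_apply, π.lieRepW_apply, ← hρ, ← hρ]
  rw [h1, ← map_smul, ← sub_eq_zero, ← map_sub] at h2
  have h3 := (Submodule.Quotient.mk_eq_zero π.kerQuot).1 h2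
  simp only [AutomorphicRepData.kerQuot, Submodule.mem_comap, Submodule.subtype_apply, hW', Submodule.mem_bot,
    ZeroMemClass.coe_eq_zero, sub_eq_zero] at h3
  exact h3

open Literature.NumberTheory.DiophantineGeometry Literature.Barriers.Langlands in
/-- **The Casimir scalar of a cohomological `π`**: if `π = W / ⊥` has an infinity type whose `a`-multisets
are those of the cohomological type of `λ^∨` (the hypothesis of
`ConeDictionary.Clozel1990_exists_basic_levelFixed_cocycle`), the trace-form Casimir operator acts on
`W` by `∑_σ (∑_i (λ_{σ,i} + ρ_i)² - ∑_i ρ_i²)` (`= ∑_σ (|λ_σ^∨ + ρ|² - |ρ|²)`, reindexing `i ↦ n-1-i`) —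
the Casimir scalar of the coefficient system `E_λ`, input (i) of the Kuga reduction.
[cite: BorelWallach2000, II §3.1] [cite: Clozel1990, Lemme 3.14 (p. 114)] -/
theorem op_lieRepW_apply_of_cohomological (π : AutomorphicRepData (AutomorphyDatum.gl n K hcpt))
    (lam : (K →+* ℂ) → Fin n → ℤ) (hW' : π.W' = ⊥) {T : InfinityType K n} (hT : π.HasInfinityType T)
    (hTa : ∀ τ : K →+* ℂ, (T τ).map ArchWeight.a =
      (cohomologicalInfinityType n K (Weight.dual (lam τ)) τ).map ArchWeight.a) (v : π.W) :
    GKCasimir.op (AutomorphyDatum.gl n K hcpt).arch π.lieRepW (bD n K hcpt) (dD n K hcpt) v =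
      (∑ σ : K →+* ℂ, (∑ i : Fin n, ((lam σ i : ℂ) + rhoGL n i) ^ 2 - ∑ i : Fin n, rhoGL n i ^ 2)) • v := by
  rw [op_lieRepW_apply_of_hasArchParameter π hW' hT.2 v]
  congr 1
  refine Finset.sum_congr rfl fun σ _ => ?_
  congr 1
  rw [hTa σ]
  change ((Finset.univ.val.map (cohomologicalArchWeight n (Weight.dual (lam σ)))).map ArchWeight.a |>.map
    fun s : ℂ => s ^ 2).sum = _
  rw [Multiset.map_map, Multiset.map_map, ← Finset.sum_eq_multiset_sum]
  simp only [Function.comp_apply, cohomologicalArchWeight_a, Weight.dual, Int.cast_neg]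
  -- reindex `i ↦ rev i`: `(-λ_{rev i} + ρ_i)² = (λ_{rev i} + ρ_{rev i})²`
  refine Fintype.sum_equiv Fin.revPerm _ _ fun i => ?_
  rw [Fin.revPerm_apply, rhoGL_rev]
  ring

end ConeDictionary

end Literature.NumberTheory.Automorphic

end
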